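import Literature.AlgebraicGeometry.Resolution.RidgeCone
import Literature.AlgebraicGeometry.Resolution.WeightedCentreHasseSubspace
import Literature.Computability.AlgebraicComplexity.SymbolicMatrixDecomposition
import Summits.ResolutionOfSingularities.ResolutionOfSingularities.Theorems.MarkedTransferCampaignW46TamePolar
import Mathlib.Algebra.Polynomial.Roots
import HarnessLib

/-!
# [OURS · L1 W4.6, rung (iv) «large characteristic»] The tame ridge is the polar kernel: for a form `F` of
# degree `b` with `1, …, b` invertible, Giraud's ridge of the cone `F = 0` has `k'`-points
# `{v ∈ k'^n | Σ_i v_i ∂F/∂Y_i = 0}` over every field `k' ⊇ k` — so in regime (iv) the ridge is the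
# (base change of the) directrix, and the threshold `b < p` is sharp
# (cell res-hironaka, LADDER-RESOLUTION rung L, D-0089; slot W4.6, seat res-L1-s46-pv-7; host route MarkedTransfer,
# `--supports stmt-ResolutionOfSingularities-16155 --as helper`)

HONEST FRAMING. Nothing here is a statement of H. Hironaka's manuscript (2017-03-23, [Hironaka2017]) and nothing here
asserts that any statement of it holds. Self-contained commutative algebra over the TREE's vocabulary: Giraud's ridge
functor `Literature.AlgebraicGeometry.Resolution.ridge k' I` (`Ridge.lean`: the `k'`-points `v` with
`L_v(C ×_K k') ⊆ C ×_K k'`), its cone property `smul_mem_ridge'` (`RidgeCone.lean`), the shift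
`Literature.RingTheory.MvPolynomial.shift`, the directional Hasse derivatives `WeightedBlowup.HasseDir.dirShift/hasseD`,
and this seat's `TamePolar` (p481074). No premise of the manuscript, no FACT-LIST premise. AI review is weaker than
expert review. No `sorry`; axioms standard.

## Why (the barrier `DirectrixSmallCharacteristic`, read from the other side)

The barrier's formal core is an ADDITIVE form of degree `p` (Hironaka's quadric in characteristic `2`) whose ridge is the
whole cone (tree: `ridgeDim_span_singleton`) while its directrix is a point: in SMALL characteristic relative to the degree
the ridge — the group scheme that governs near points (Giraud, CJS Rem. 18.29) — is strictly bigger than the directrix.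
This file proves that in the TAME degrees this cannot happen, point-wise over every field extension:

* `mem_ridge_span_singleton_iff` / `shift_map_eq_self_of_mem_ridge` — for a form `F` of degree `b`, `v ∈ F(k')` iff
  `F(X + v) ∈ (F) · k'[X]` iff `F(X + v) = F(X)` in `k'[X]` (degree bookkeeping: a multiple of `F` has no components
  below degree `b`, a translate of `F` has top component `F`; every characteristic).
* `hasseD_eq_zero_of_forall_shift_smul_eq` — if `F(X + cv) = F(X)` for ALL scalars `c ∈ k'` and `1, …, deg F` are
  non-zero in `k'`, then every positive-order Hasse derivative `D_v^{(j)} F` vanishes (the `T`-polynomial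
  `F(X + Tv) − F(X)` of degree `≤ deg F` has more roots `c = 0, 1, …, deg F` than its degree).
* `mem_ridge_span_singleton_iff_polar_eq_zero` — **THE TAME RIDGE IS THE POLAR KERNEL**: for `F` homogeneous of
  degree `b` with `1, …, b` non-zero in `K` (characteristic `0`, or `p > b`) and every field `k' ⊇ K`,
  `v ∈ F(k') ⟺ Σ_i v_i (∂F/∂Y_i)(X) = 0` in `k'[X]` (the ridge is a cone: `c • v ∈ F(k')`, tree `smul_mem_ridge'`).
  With `TamePolar.invarianceSpace_singleton_eq_ker_polar` (𝕎({F}) = polar kernel over `K`):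
  `mem_ridge_span_singleton_iff_mem_invarianceSpace` — on `K`-points the ridge of a tame form IS Hironaka's
  invariance space (whose annihilator is the directrix), and over extensions `k'` it is cut out by the SAME `K`-linear
  equations: no purely inseparable group-scheme structure survives in regime (iv) («ridge = directrix», Schober 2021
  Rem. 2.6 for characteristic `0`; here for `p > b`).
* SHARPNESS at `b = p`: `single_notMem_ridge_X_pow` — `e_0 ∉ F(K)` for `F = Y_0^p` (the ridge lies on the cone,
  `F(e_0) = 1`), although in characteristic `p` the polar kernel of `Y_0^p` is everything
  (`TamePolar.ker_polar_X_pow_char_eq_top`): `ridge_X_pow_char_ne_ker_polar`.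

So, as for the directrix (p481074), the honest constant of regime (iv) for the RIDGE step is `C = b ≤ d`, independent of
the dimension: for `p > d` the secondary invariant of CJS/CPS needs no group-scheme correction at the first stage.
## References (context; nothing is cited as a premise)

* J. Giraud, Ann. Sci. ÉNS 8 (1975) §1.5 [cite: Giraud1975, §1.5]; Berthomieu–Hivert–Mourtada, Contemp. Math. 521
  (2010), Def. 1.2, Lemma 3.6 [cite: BerthomieuHivertMourtada2010, Def. 1.2, Lemma 3.6]; B. Schober, J. Algebra 567
  (2021), Rem. 2.6 («char 0: Dir(C) = Rid(C)») [cite: Schober2021IdealisticExponents, Rem. 2.6]; barrier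
  `DirectrixSmallCharacteristic`; tree `Ridge.lean`, `RidgeCone.lean`, `RidgeRepresentable.lean`.
-/

noncomputable section

set_option linter.dupNamespace false -- mandated namespace of this single-conjunct summit

namespace Summit.ResolutionOfSingularities.ResolutionOfSingularities.Theorems
namespace CampaignW46
namespace TameRidge

open MvPolynomial
open Literature.RingTheory.MvPolynomial
open Literature.AlgebraicGeometry.Resolution
open Literature.AlgebraicGeometry.Resolution.WeightedBlowup.HasseDir

universe u v

/-! ## Degree bookkeeping for a form and its translates (every characteristic) -/

section Degree

variable {σ : Type*} {R : Type*} [CommSemiring R]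

/-- A multiple of a form of degree `b` has no coefficients in degree `< b`. [folklore] -/
theorem coeff_mul_eq_zero_of_degree_lt {G : MvPolynomial σ R} {b : ℕ} (hG : G.IsHomogeneous b)
    (g : MvPolynomial σ R) {m : σ →₀ ℕ} (hm : m.degree < b) : coeff m (g * G) = 0 := by
  classical
  rw [coeff_mul]
  refine Finset.sum_eq_zero fun x hx => ?_
  rw [Finset.mem_antidiagonal] at hx
  have hdeg : x.2.degree ≤ m.degree := by
    rw [← hx, map_add]
    exact Nat.le_add_left _ _
  rw [hG.coeff_eq_zero (by omega), mul_zero]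

end Degree

section Shift

variable {σ : Type*} [DecidableEq σ] {k : Type*} [Field k]

omit [DecidableEq σ] in
/-- The tree's shift `X_i ↦ X_i + w_i` is the evaluation homomorphism `eval₂Hom C (X + C w)` (bridge to the vocabulary
of `Literature.Computability.AlgebraicComplexity.homogeneousComponent_translate_monomial`). [folklore] -/
theorem shift_eq_eval₂Hom (w : σ → k) (P : MvPolynomial σ k) :
    shift w P = eval₂Hom C (fun i => X i + C (w i)) P := by
  revert P
  refine fun P => RingHom.congr_fun (f := (shift w : MvPolynomial σ k →+* MvPolynomial σ k))
    (g := eval₂Hom C (fun i => X i + C (w i))) (MvPolynomial.ringHom_ext (fun r => ?_) (fun i => ?_)) P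
  · simp [shift]
  · simp [shift_X]

/-- **The top component of a translated form is the form**: `H_b[G(X + w)] = G` for `G` homogeneous of degree `b`
(over a field). [folklore] -/
theorem homogeneousComponent_shift_of_isHomogeneous {G : MvPolynomial σ k} {b : ℕ} (hG : G.IsHomogeneous b)
    (w : σ → k) : homogeneousComponent b (shift w G) = G := by
  conv_lhs => rw [G.as_sum]
  rw [map_sum, map_sum]
  conv_rhs => rw [← G.support_sum_monomial_coeff]
  refine Finset.sum_congr rfl fun s hs => ?_
  have hdeg : s.degree = b := by
    by_contra h
    exact (mem_support_iff.mp hs) (hG.coeff_eq_zero h)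
  rw [shift_eq_eval₂Hom, ← hdeg]
  exact Literature.Computability.AlgebraicComplexity.homogeneousComponent_translate_monomial w s (coeff s G)

/-- **A translate of a form that is a multiple of the form equals the form**: if `G` is homogeneous of degree `b` and
`G(X + w) ∈ (G)`, then `G(X + w) = G(X)` — below degree `b` a multiple of `G` vanishes, in degree `b` the translate
has component `G`, above degree `b` the translate vanishes. [folklore] -/
theorem shift_eq_self_of_mem_span {G : MvPolynomial σ k} {b : ℕ} (hG : G.IsHomogeneous b) {w : σ → k}
    (h : shift w G ∈ Ideal.span ({G} : Set (MvPolynomial σ k))) : shift w G = G := by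
  obtain ⟨g, hg⟩ := Ideal.mem_span_singleton'.mp h
  ext m
  rcases lt_trichotomy m.degree b with hlt | heq | hgt
  · rw [← hg, coeff_mul_eq_zero_of_degree_lt hG g hlt, hG.coeff_eq_zero (ne_of_lt hlt)]
  · have := congrArg (coeff m) (homogeneousComponent_shift_of_isHomogeneous hG w)
    rwa [coeff_homogeneousComponent, if_pos heq] at this
  · have hdeg : (shift w G).totalDegree < ∑ i ∈ m.support, m i := by
      rw [← Finsupp.degree_apply]
      exact (totalDegree_shift_le w G).trans_lt (hG.totalDegree_le.trans_lt hgt)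
    rw [coeff_eq_zero_of_totalDegree_lt hdeg, hG.coeff_eq_zero (ne_of_gt hgt)]

end Shift

/-! ## Shifts along a line versus directional Hasse derivatives -/

section Hasse

variable {σ : Type*} {R : Type*} [CommRing R]

/-- `G(X + c v)` is the value at `T = c` of the directional shift `G(X + Tv)`. [folklore] -/
theorem eval_C_dirShift (v : σ → R) (c : R) (G : MvPolynomial σ R) :
    Polynomial.eval (C c) (dirShift v G) = shift (c • v) G := by
  have key : ((Polynomial.aeval (R := MvPolynomial σ R) (C c : MvPolynomial σ R)).restrictScalars R).comp
      (dirShift v) = shift (c • v) := by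
    refine MvPolynomial.algHom_ext fun i => ?_
    simp only [AlgHom.comp_apply, AlgHom.restrictScalars_apply, dirShift_X, Polynomial.coe_aeval_eq_eval,
      Polynomial.eval_add, Polynomial.eval_C, Polynomial.eval_mul, Polynomial.eval_X, shift_X, Pi.smul_apply,
      smul_eq_mul, C_mul]
    ring
  have h := congrArg (fun φ : MvPolynomial σ R →ₐ[R] MvPolynomial σ R => φ G) key
  simpa only [AlgHom.comp_apply, AlgHom.restrictScalars_apply, Polynomial.coe_aeval_eq_eval] using h

/-- All positive-order Hasse derivatives along `v` vanish iff `G(X + Tv) = G(X)` formally in `T`. [folklore] -/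
theorem dirShift_eq_C_iff (v : σ → R) (G : MvPolynomial σ R) :
    dirShift v G = Polynomial.C G ↔ ∀ j : ℕ, 1 ≤ j → hasseD v j G = 0 := by
  constructor
  · intro h j hj
    rw [hasseD_def, h, Polynomial.coeff_C, if_neg (by omega)]
  · intro h
    refine Polynomial.ext fun j => ?_
    rw [Polynomial.coeff_C]
    split_ifs with hj
    · rw [hj, ← hasseD_def, hasseD_zero]
    · rw [← hasseD_def]
      exact h j (Nat.one_le_iff_ne_zero.mpr hj)

/-- The polar `Σ_i v_i ∂_i G` is the first Hasse derivative `D_v^{(1)} G` (from `TamePolar.hasseD_polar` at `j = 0`).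
[folklore] -/
theorem polar_eq_hasseD_one [Fintype σ] (v : σ → R) (G : MvPolynomial σ R) :
    ∑ i, C (v i) * pderiv i G = hasseD v 1 G := by
  have h := TamePolar.hasseD_polar v 0 G
  simpa only [hasseD_zero, Nat.cast_zero, zero_add, mul_one] using h

end Hasse

section HasseField

variable {σ : Type*} {k : Type*} [Field k]

/-- In a field where `1, …, N` are non-zero, the scalars `0, 1, …, N` are pairwise distinct. [folklore] -/
theorem natCast_fin_injective {N : ℕ} (hchar : ∀ m : ℕ, 1 ≤ m → m ≤ N → (m : k) ≠ 0) :
    Function.Injective fun i : Fin (N + 1) => ((i : ℕ) : k) := by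
  intro i j hij
  simp only at hij
  rcases le_total (i : ℕ) j with hle | hle
  · by_contra hne
    have hlt : (i : ℕ) < j := lt_of_le_of_ne hle fun h => hne (Fin.ext h)
    have h0 : (((j : ℕ) - i : ℕ) : k) = 0 := by rw [Nat.cast_sub hle, ← hij, sub_self]
    exact hchar _ (by omega) (by omega) h0
  · by_contra hne
    have hlt : (j : ℕ) < i := lt_of_le_of_ne hle fun h => hne (Fin.ext h.symm)
    have h0 : (((i : ℕ) - j : ℕ) : k) = 0 := by rw [Nat.cast_sub hle, hij, sub_self]
    exact hchar _ (by omega) (by omega) h0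

/-- **Invariance under a whole line of translations kills the Hasse derivatives (tame degrees).** If
`G(X + cv) = G(X)` for every scalar `c ∈ k` and `1, …, deg G` are non-zero in `k`, then `D_v^{(j)} G = 0` for all
`j ≥ 1`: the `T`-polynomial `G(X + Tv) − G(X)` has degree `≤ deg G` and the `deg G + 1` distinct roots
`0, 1, …, deg G`. [folklore] -/
theorem hasseD_eq_zero_of_forall_shift_smul_eq (v : σ → k) {G : MvPolynomial σ k}
    (hchar : ∀ m : ℕ, 1 ≤ m → m ≤ G.totalDegree → (m : k) ≠ 0)
    (h : ∀ c : k, shift (c • v) G = G) : ∀ j : ℕ, 1 ≤ j → hasseD v j G = 0 := by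
  rw [← dirShift_eq_C_iff]
  rw [← sub_eq_zero]
  set Q := dirShift v G - Polynomial.C G with hQ
  have hdeg : Q.natDegree < Fintype.card (Fin (G.totalDegree + 1)) := by
    rw [Fintype.card_fin, Nat.lt_succ_iff, hQ]
    refine (Polynomial.natDegree_sub_le _ _).trans ?_
    rw [Polynomial.natDegree_C, max_eq_left (Nat.zero_le _)]
    exact natDegree_dirShift_le v G
  refine Polynomial.eq_zero_of_natDegree_lt_card_of_eval_eq_zero Q
    (f := fun i : Fin (G.totalDegree + 1) => (C ((i : ℕ) : k) : MvPolynomial σ k)) ?_ ?_ hdeg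
  · intro i j hij
    exact natCast_fin_injective hchar ((C_injective σ k) hij)
  · intro i
    simp only [hQ, Polynomial.eval_sub, Polynomial.eval_C, eval_C_dirShift, h, sub_self]

/-- Conversely (tame degrees): a vanishing polar gives invariance under the whole line of translations,
`G(X + cv) = G(X)` for every `c` (via `TamePolar.hasseD_eq_zero_of_polar_eq_zero`). [folklore] -/
theorem shift_smul_eq_of_polar_eq_zero [Fintype σ] (v : σ → k) {G : MvPolynomial σ k}
    (hchar : ∀ m : ℕ, 1 ≤ m → m ≤ G.totalDegree → (m : k) ≠ 0)
    (hpol : ∑ i, C (v i) * pderiv i G = 0) (c : k) : shift (c • v) G = G := by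
  have h := (dirShift_eq_C_iff v G).mpr (TamePolar.hasseD_eq_zero_of_polar_eq_zero v hchar hpol)
  rw [← eval_C_dirShift, h, Polynomial.eval_C]

end HasseField

/-! ## The ridge of the cone of one form -/

section Ridge

variable {K : Type u} [Field K] {n : ℕ}

/-- The cone ideal of a principal ideal is principal: `(F) · k'[X] = (F ⊗ 1)`. [folklore] -/
theorem coneIdeal_span_singleton (k' : Type v) [CommRing k'] [Algebra K k'] (F : MvPolynomial (Fin n) K) :
    coneIdeal k' (Ideal.span {F}) = Ideal.span {MvPolynomial.map (algebraMap K k') F} := by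
  rw [coneIdeal, Ideal.map_span, Set.image_singleton]

/-- **Points of the ridge of a hypersurface cone**: `v ∈ F(k')` iff `F(X + v) ∈ (F) · k'[X]` (it suffices to
translate the generator). [folklore] -/
theorem mem_ridge_span_singleton_iff {k' : Type v} [CommRing k'] [Algebra K k'] (F : MvPolynomial (Fin n) K)
    (v : Fin n → k') :
    v ∈ ridge k' (Ideal.span {F}) ↔
      shift v (MvPolynomial.map (algebraMap K k') F) ∈
        Ideal.span ({MvPolynomial.map (algebraMap K k') F} : Set (MvPolynomial (Fin n) k')) := by
  rw [mem_ridge_iff_forall_mem, coneIdeal_span_singleton]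
  constructor
  · intro h
    exact h F (Ideal.mem_span_singleton_self F)
  · intro h f hf
    obtain ⟨g, rfl⟩ := Ideal.mem_span_singleton'.mp hf
    rw [map_mul, map_mul]
    exact Ideal.mul_mem_left _ _ h

/-- If `F(X + v) = F(X)` in `k'[X]` then `v ∈ F(k')` (every characteristic, every commutative `K`-algebra `k'`).
[folklore] -/
theorem mem_ridge_of_shift_map_eq_self {k' : Type v} [CommRing k'] [Algebra K k'] (F : MvPolynomial (Fin n) K)
    {v : Fin n → k'} (h : shift v (MvPolynomial.map (algebraMap K k') F) = MvPolynomial.map (algebraMap K k') F) :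
    v ∈ ridge k' (Ideal.span {F}) := by
  rw [mem_ridge_span_singleton_iff, h]
  exact Ideal.mem_span_singleton_self _

/-- **The ridge of a form is its translation stabiliser**: for `F` homogeneous of degree `b` and a field `k' ⊇ K`,
`v ∈ F(k')` forces `F(X + v) = F(X)` in `k'[X]` (every characteristic). [folklore] -/
theorem shift_map_eq_self_of_mem_ridge {k' : Type v} [Field k'] [Algebra K k'] {F : MvPolynomial (Fin n) K} {b : ℕ}
    (hF : F.IsHomogeneous b) {v : Fin n → k'} (hv : v ∈ ridge k' (Ideal.span {F})) :
    shift v (MvPolynomial.map (algebraMap K k') F) = MvPolynomial.map (algebraMap K k') F :=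
  shift_eq_self_of_mem_span (hF.map _) ((mem_ridge_span_singleton_iff F v).mp hv)

/-- A principal ideal generated by a form is homogeneous (closed under homogeneous components) — the hypothesis of
the tree's cone lemma `smul_mem_ridge'`. [folklore] -/
theorem homogeneousComponent_mem_span_singleton {F : MvPolynomial (Fin n) K} {b : ℕ} (hF : F.IsHomogeneous b) :
    ∀ f ∈ Ideal.span ({F} : Set (MvPolynomial (Fin n) K)), ∀ d : ℕ,
      homogeneousComponent d f ∈ Ideal.span ({F} : Set (MvPolynomial (Fin n) K)) := by
  intro f hf d
  obtain ⟨g, rfl⟩ := Ideal.mem_span_singleton'.mp hf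
  have hg : g * F = ∑ i ∈ Finset.range (g.totalDegree + 1), homogeneousComponent i g * F := by
    rw [← Finset.sum_mul, sum_homogeneousComponent]
  rw [hg, map_sum]
  refine Ideal.sum_mem _ fun i _ => ?_
  have hmem : homogeneousComponent i g * F ∈ homogeneousSubmodule (Fin n) K (i + b) :=
    (mem_homogeneousSubmodule _ _).mpr ((homogeneousComponent_isHomogeneous i g).mul hF)
  rw [homogeneousComponent_of_mem hmem]
  split_ifs
  · exact Ideal.mul_mem_left _ _ (Ideal.mem_span_singleton_self F)
  · exact Ideal.zero_mem _

/-- Transport of the tameness hypothesis «`1, …, N` non-zero» from `K` to a field extension `k'`. [folklore] -/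
theorem natCast_ne_zero_of_algebra {k' : Type v} [Field k'] [Algebra K k'] {N : ℕ}
    (hchar : ∀ m : ℕ, 1 ≤ m → m ≤ N → (m : K) ≠ 0) : ∀ m : ℕ, 1 ≤ m → m ≤ N → (m : k') ≠ 0 := by
  intro m h1 hm h0
  apply hchar m h1 hm
  apply (algebraMap K k').injective
  rw [map_natCast, h0, map_zero]

/-- [OURS · L1 W4.6 (iv); NOT a statement of the manuscript] **Tame forms: a vanishing polar puts `v` in the ridge**
(every field `k' ⊇ K`, any universe): if `F` is homogeneous of degree `b`, `1, …, b` are non-zero in `K`, and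
`Σ_i v_i (∂F/∂Y_i) = 0` in `k'[X]`, then `v ∈ F(k')`. [folklore] -/
theorem mem_ridge_of_polar_eq_zero {k' : Type v} [Field k'] [Algebra K k'] {F : MvPolynomial (Fin n) K} {b : ℕ}
    (hF : F.IsHomogeneous b) (hchar : ∀ m : ℕ, 1 ≤ m → m ≤ b → (m : K) ≠ 0) {v : Fin n → k'}
    (hpol : ∑ i, C (v i) * pderiv i (MvPolynomial.map (algebraMap K k') F) = 0) :
    v ∈ ridge k' (Ideal.span {F}) := by
  refine mem_ridge_of_shift_map_eq_self F ?_
  have hchar' : ∀ m : ℕ, 1 ≤ m → m ≤ (MvPolynomial.map (algebraMap K k') F).totalDegree → (m : k') ≠ 0 :=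
    fun m h1 hm => natCast_ne_zero_of_algebra hchar m h1 (hm.trans (hF.map _).totalDegree_le)
  have h := shift_smul_eq_of_polar_eq_zero v hchar' hpol 1
  rwa [one_smul] at h

/-- [OURS · L1 W4.6 (iv); NOT a statement of the manuscript] **Tame forms: the ridge lies in the polar kernel**
(fields `k' ⊇ K` in the universe of `K`, where the tree's cone lemma `smul_mem_ridge'` lives): if `F` is homogeneous
of degree `b`, `1, …, b` are non-zero in `K` and `v ∈ F(k')`, then `Σ_i v_i (∂F/∂Y_i) = 0` in `k'[X]` — the whole line
`c • v` lies in the ridge, so `F(X + cv) = F(X)` for all `c`, so all Hasse derivatives along `v` vanish. [folklore] -/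
theorem polar_eq_zero_of_mem_ridge {k' : Type u} [Field k'] [Algebra K k'] {F : MvPolynomial (Fin n) K} {b : ℕ}
    (hF : F.IsHomogeneous b) (hchar : ∀ m : ℕ, 1 ≤ m → m ≤ b → (m : K) ≠ 0) {v : Fin n → k'}
    (hv : v ∈ ridge k' (Ideal.span {F})) :
    ∑ i, C (v i) * pderiv i (MvPolynomial.map (algebraMap K k') F) = 0 := by
  have hchar' : ∀ m : ℕ, 1 ≤ m → m ≤ (MvPolynomial.map (algebraMap K k') F).totalDegree → (m : k') ≠ 0 :=
    fun m h1 hm => natCast_ne_zero_of_algebra hchar m h1 (hm.trans (hF.map _).totalDegree_le)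
  have hline : ∀ c : k', shift (c • v) (MvPolynomial.map (algebraMap K k') F) =
      MvPolynomial.map (algebraMap K k') F :=
    fun c => shift_map_eq_self_of_mem_ridge hF (smul_mem_ridge' (homogeneousComponent_mem_span_singleton hF) c hv)
  rw [polar_eq_hasseD_one]
  exact hasseD_eq_zero_of_forall_shift_smul_eq v hchar' hline 1 le_rfl

/-- [OURS · L1 W4.6 (iv); NOT a statement of the manuscript] **THE TAME RIDGE IS THE POLAR KERNEL.** For a form `F`
of degree `b` over `K` with `1, …, b` non-zero in `K` (characteristic `0`, or `p > b`) and every field `k' ⊇ K` (in the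
universe of `K`): the `k'`-points of Giraud's ridge of the cone `F = 0` are exactly the solutions of the `K`-LINEAR
system `Σ_i v_i ∂F/∂Y_i = 0`. In particular the ridge acquires no new points over inseparable extensions — contrast
the additive forms of degree `p^e` of the barrier (`ridgeDim_span_singleton`). [folklore] -/
theorem mem_ridge_span_singleton_iff_polar_eq_zero {k' : Type u} [Field k'] [Algebra K k']
    {F : MvPolynomial (Fin n) K} {b : ℕ} (hF : F.IsHomogeneous b)
    (hchar : ∀ m : ℕ, 1 ≤ m → m ≤ b → (m : K) ≠ 0) (v : Fin n → k') :
    v ∈ ridge k' (Ideal.span {F}) ↔ ∑ i, C (v i) * pderiv i (MvPolynomial.map (algebraMap K k') F) = 0 :=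
  ⟨polar_eq_zero_of_mem_ridge hF hchar, mem_ridge_of_polar_eq_zero hF hchar⟩

/-- [OURS · L1 W4.6 (iv)] **Characteristic `p > b`** version of the tame ridge theorem. [folklore] -/
theorem mem_ridge_span_singleton_iff_polar_eq_zero_of_lt_char (p : ℕ) [CharP K p] {k' : Type u} [Field k']
    [Algebra K k'] {F : MvPolynomial (Fin n) K} {b : ℕ} (hF : F.IsHomogeneous b) (hb : b < p) (v : Fin n → k') :
    v ∈ ridge k' (Ideal.span {F}) ↔ ∑ i, C (v i) * pderiv i (MvPolynomial.map (algebraMap K k') F) = 0 :=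
  mem_ridge_span_singleton_iff_polar_eq_zero hF (TamePolar.natCast_ne_zero_of_lt_char p hb) v

/-- [OURS · L1 W4.6 (iv); NOT a statement of the manuscript] **Tame forms: ridge = invariance space on `K`-points.**
For a form `F` of degree `b` with `1, …, b` non-zero in `K`, a vector `v ∈ K^n` lies in Giraud's ridge of the cone
`F = 0` iff it lies in Hironaka's invariance space `𝕎({F})` (whose annihilator is the directrix): «Rid = Dir» in regime
(iv) (Schober 2021, Rem. 2.6, there for characteristic `0`). [folklore] -/
theorem mem_ridge_span_singleton_iff_mem_invarianceSpace {F : MvPolynomial (Fin n) K} {b : ℕ}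
    (hF : F.IsHomogeneous b) (hchar : ∀ m : ℕ, 1 ≤ m → m ≤ b → (m : K) ≠ 0) (v : Fin n → K) :
    v ∈ ridge K (Ideal.span {F}) ↔ v ∈ invarianceSpace K ({F} : Set (MvPolynomial (Fin n) K)) := by
  have hchar' : ∀ m : ℕ, 1 ≤ m → m ≤ F.totalDegree → (m : K) ≠ 0 :=
    fun m h1 hm => hchar m h1 (hm.trans hF.totalDegree_le)
  rw [mem_ridge_span_singleton_iff_polar_eq_zero hF hchar, Algebra.algebraMap_self, map_id,
    TamePolar.invarianceSpace_singleton_eq_ker_polar K F hchar', LinearMap.mem_ker, Fintype.linearCombination_apply]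
  simp [MvPolynomial.smul_eq_C_mul]

end Ridge

/-! ## Sharpness at `b = p`: the additive form `Y_0^p` -/

section Sharp

variable (K : Type u) [Field K] {d : ℕ}

/-- **`e_0` is not in the ridge of `Y_0^p`** (any exponent `p ≥ 1`, any characteristic): the ridge lies on the cone
(tree `aeval_eq_zero_of_mem_ridge`) and `Y_0^p(e_0) = 1`. [folklore] -/
theorem single_notMem_ridge_X_pow {p : ℕ} (hp : 1 ≤ p) :
    (Pi.single 0 1 : Fin (d + 1) → K) ∉
      ridge K (Ideal.span {((X 0 : MvPolynomial (Fin (d + 1)) K) ^ p)}) := by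
  intro h
  have hI : Ideal.span {((X 0 : MvPolynomial (Fin (d + 1)) K) ^ p)} ≤
      RingHom.ker (constantCoeff : MvPolynomial (Fin (d + 1)) K →+* K) := by
    rw [Ideal.span_le, Set.singleton_subset_iff, SetLike.mem_coe, RingHom.mem_ker, map_pow, constantCoeff_X,
      zero_pow (by omega)]
  have h0 := aeval_eq_zero_of_mem_ridge hI h (Ideal.mem_span_singleton_self _)
  simp at h0

/-- [OURS · L1 W4.6 (iv)] **Sharpness of `b < p` for the ridge.** In characteristic `p` the polar kernel of `Y_0^p` is
everything (`TamePolar.ker_polar_X_pow_char_eq_top`) but `e_0` is not a `K`-point of the ridge: the tame equality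
«ridge = polar kernel» fails at degree `p`. [folklore] -/
theorem ridge_X_pow_char_ne_ker_polar (p : ℕ) [Fact p.Prime] [CharP K p] :
    ∃ v : Fin (d + 1) → K,
      (∑ i, C (v i) * pderiv i ((X 0 : MvPolynomial (Fin (d + 1)) K) ^ p) = 0) ∧
        v ∉ ridge K (Ideal.span {((X 0 : MvPolynomial (Fin (d + 1)) K) ^ p)}) := by
  refine ⟨Pi.single 0 1, ?_, single_notMem_ridge_X_pow K (Fact.out : p.Prime).one_lt.le⟩
  simp [TamePolar.pderiv_X_zero_pow_char K p]

end Sharp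

end TameRidge
end CampaignW46
end Summit.ResolutionOfSingularities.ResolutionOfSingularities.Theorems

end
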